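import Literature.IUT.HodgeArakelov.GaloisPairCyclotomesBridge
import Literature.IUT.HodgeArakelov.MonoThetaCor110SubdagStatements
import HarnessLib

/-!
# Bridge B12 (`Π`-side junction): Cor. 1.11's `(l·Δ_Θ)(Π)` IS Cor. 1.10's `(l·Δ_Θ)(Π)`

Mochizuki, *Inter-universal Teichmüller theory II*, §1, Corollary 1.11 (b), kurims manuscript (Dec. 2020) p. 49
ll. 22–35: "the `Aut(G)`-orbit … of isomorphisms `μ_Ẑ(G) ⥲ (l·Δ_Θ)(Π)` obtained by composing … `α : Π/Δ ⥲ G` …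
with the natural isomorphism `μ_Ẑ(G_k) ⥲ μ_Ẑ(Π_X)` of [AbsTopIII], Corollary 1.10, (c)", and "the topological
`Π`-module constituted by the codomain of `(*bs-Gal_{G,Π})`"; Corollary 1.10, p. 47: "the data consisting of the
topological group `Π`, the topological `Π`-modules constituted by the domain [`(l·Δ_Θ)(Π)`] and codomain of
`(∗mono-Θ_Π)`" [claim: Mochizuki2012, status: disputed] (IUTchII §1 Cor 1.11, kurims p.49). Record-only typing
under the claim key `Mochizuki2012` (D-0012, disputed); abc-iut cell, layer L6, `plan/L6/MERGE-MAP.md` §8 row B12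
(holder abc-iut-w4-d024), nodes `IUTchII:Cor1.11` / `IUTchII:Cor1.10`.

JUNCTION. The B12 bridge `GaloisPairCyclotomesBridge.lean` (p416294) leaves the `Π`-side of Cor. 1.11 as the
named input `GalThetaSyncInput A`: an ABSTRACT assignment `Π ↦ (l·Δ_Θ)(Π)` with functorial transport, plus the
[AbsTopIII] Cor. 1.10 (c) isomorphism `corPiX : μ_Ẑ(Π/Δ) ⥲ (l·Δ_Θ)(Π)` natural through `quotMap`. The Cor. 1.10
sub-DAG (`MonoThetaCor110SubdagStatements.lean`, abc-iut-w5-d145) types the OUTPUT of the functorial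
group-theoretic algorithm `Π ↦ ((l·Δ_Θ)(Π), Π_μ(M^Θ_*(Π)), (∗mono-Θ_Π))` as `MonoThetaRigidityData S`
(`intCyc`, `actInt`, `mapInt` + laws; reduced to one base datum + the [EtTh] Cor. 2.18/2.19 action by
`MonoThetaCor110FamilyOfBase.lean`). Print uses THE SAME `(l·Δ_Θ)(Π)` in both corollaries, so this file FEEDS
the `(l·Δ_Θ)` half of Cor. 1.11's `Π`-input from Cor. 1.10's family:

* `GalCorPiXInput A D` — the residual input: ONLY the [AbsTopIII] Cor. 1.10 (c) isomorphism
  `μ_Ẑ(Π/Δ) ⥲ (l·Δ_Θ)(Π)` (source the GENUINE group-theoretic cyclotome of `Π/Δ`, target Cor. 1.10's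
  `D.intCyc Π`), its naturality through the CONSTRUCTED `quotMap` and Cor. 1.10's transport `D.mapInt`, and its
  `Π`-EQUIVARIANCE ("topological `Π`-module": the conjugation action of `Π/Δ` on `μ_Ẑ(Π/Δ)` — abc-iut-L4-t1's
  `muZhat.instMulDistribMulAction`, the cyclotomic character — versus Cor. 1.10's `D.actInt`); owner side:
  FACT-LIST F-0348 `AbsTopIII.CurveModel.Cor_1_10_ii_c` in the `CurveModel` vocabulary (abc-iut-L4-t1);
* `GalThetaSyncInput.ofMonoThetaRigidityData D C` — Cor. 1.11's `Π`-input with `(l·Δ_Θ)(Π) := D.intCyc Π` and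
  `mapLD := D.mapInt` (functor laws = Cor. 1.10's), PROVED bookkeeping;
* `GaloisPairRigidityData.ofGaloisCyclotomeCor110` — the B12 instance whose (b)-codomain IS Cor. 1.10's
  `(l·Δ_Θ)(Π)`, with `cor111FunctorCor110` (+ multiradiality) and the definitional checks
  `cor111FunctorCor110_obj_L` / `cor111FunctorCor110_map_l` (the `(l·Δ_Θ)`-entry of the tuple and of the
  induced morphism are Cor. 1.10's `intCyc` / `mapInt`);
* `orbitB_equivariant` — every member of the orbit (b) `(*bs-Gal_{G,Π})` is `Π`-semilinear along the chosen
  `e : G ⥲ Π/Δ` (PROVED from the equivariance field and `galCyclotomeMap_smul`).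

No named `Prop` fact; nothing of abc-iut-L6-t1 / w5-d089 / w5-d145 edited or restated; nothing here bears on
[IUTchIII] Cor. 3.12; typed ≠ discharged.
-/

noncomputable section

namespace Literature.IUT.HodgeArakelov

open CategoryTheory
open Literature.AnabelianGeometry.AbsoluteAnabelian

universe u

variable {S : ThetaSetting.{u}}

/-- The residual `Π`-side INPUT of **IUTchII:Cor1.11 (b)** once `(l·Δ_Θ)(−)` is taken from Cor. 1.10's functorial
family `D`: "the natural isomorphism `μ_Ẑ(G_k) ⥲ μ_Ẑ(Π_X)` of [AbsTopIII], Corollary 1.10, (c)" at the object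
`Π/Δ`, valued in `D.intCyc Π = (l·Δ_Θ)(Π)`, NATURAL in `Π ⥲ Π*` (through `AbsTopMonoids.quotMap` and `D.mapInt`)
and `Π`-EQUIVARIANT (conjugation action of `Π/Δ` on the genuine `μ_Ẑ(Π/Δ)` versus `D.actInt`). FACT-LIST F-0348
(`CurveModel` vocabulary) on the owner side; TODO-merge:abc-iut-L4-t1. [claim: Mochizuki2012, status: disputed]
(IUTchII §1 Cor 1.11, kurims p.49) -/
structure GalCorPiXInput [CompactSpace S.Gk] (A : AbsTopMonoids S) (D : MonoThetaRigidityData S) :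
    Type (u + 1) where
  /-- [AbsTopIII] Cor. 1.10 (c) at `Π/Δ`: `μ_Ẑ(Π/Δ) ⥲ (l·Δ_Θ)(Π)` -/
  corPiX : ∀ P : IsoClass S.PiX, (A.quotObj P).galCyclotome ≃* D.intCyc P
  /-- naturality in `Π ⥲ Π*` -/
  corPiX_natural : ∀ {P Q : IsoClass S.PiX} (h : P ⟶ Q) (x : (A.quotObj P).galCyclotome),
    corPiX Q (IsoClass.galCyclotomeMap (A.quotMap h) x) = D.mapInt h (corPiX P x)
  /-- `Π`-equivariance: `Π` acting on `μ_Ẑ(Π/Δ)` through `Π ↠ Π/Δ` and conjugation, on `(l·Δ_Θ)(Π)` by `actInt` -/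
  corPiX_equivariant : ∀ (P : IsoClass S.PiX) (x : P.G) (ζ : (A.quotObj P).galCyclotome),
    corPiX P (haveI := (A.quotObj P).compactSpace_carrier; (QuotientGroup.mk x : P.G ⧸ A.Delta P) • ζ) =
      D.actInt P x (corPiX P ζ)

/-- **Cor. 1.11's `Π`-input FED BY Cor. 1.10's family**: `(l·Δ_Θ)(Π) := D.intCyc Π`, `mapLD := D.mapInt`
(functor laws inherited), `corPiX` from the residual input. [claim: Mochizuki2012, status: disputed]
(IUTchII §1 Cor 1.11, kurims p.49) -/
def GalThetaSyncInput.ofMonoThetaRigidityData [CompactSpace S.Gk] {A : AbsTopMonoids S}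
    (D : MonoThetaRigidityData S) (C : GalCorPiXInput A D) : GalThetaSyncInput A where
  lDeltaTheta P := D.intCyc P
  grpLD _ := inferInstance
  mapLD h := D.mapInt h
  mapLD_id P := D.mapInt_id P
  mapLD_comp f g := D.mapInt_comp f g
  corPiX P := C.corPiX P
  corPiX_natural h x := C.corPiX_natural h x

/-- Its `(l·Δ_Θ)(Π)` is Cor. 1.10's `intCyc Π` (definitional). [claim: Mochizuki2012, status: disputed]
(IUTchII §1 Cor 1.11, kurims p.49) -/
theorem GalThetaSyncInput.ofMonoThetaRigidityData_lDeltaTheta [CompactSpace S.Gk] {A : AbsTopMonoids S}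
    (D : MonoThetaRigidityData S) (C : GalCorPiXInput A D) (P : IsoClass S.PiX) :
    (GalThetaSyncInput.ofMonoThetaRigidityData D C).lDeltaTheta P = ↥(D.intCyc P) :=
  rfl

/-- Its transport is Cor. 1.10's `mapInt` (definitional). [claim: Mochizuki2012, status: disputed]
(IUTchII §1 Cor 1.11, kurims p.49) -/
theorem GalThetaSyncInput.ofMonoThetaRigidityData_mapLD [CompactSpace S.Gk] {A : AbsTopMonoids S}
    (D : MonoThetaRigidityData S) (C : GalCorPiXInput A D) {P Q : IsoClass S.PiX} (h : P ⟶ Q) :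
    (GalThetaSyncInput.ofMonoThetaRigidityData D C).mapLD h = D.mapInt h :=
  rfl

namespace GaloisPairRigidityData

variable [CompactSpace S.Gk] {A : AbsTopMonoids S}

/-- **B12 over Cor. 1.10's family**: t1's `GaloisPairRigidityData A` with genuine `μ_Ẑ(G)`, `(l·Δ_Θ)(Π)` =
Cor. 1.10's `intCyc Π`, and the named inputs: twist `T`, Rmk. 3.2.1 rigidity `R`, Cor. 1.10 (c) `C`.
[claim: Mochizuki2012, status: disputed] (IUTchII §1 Cor 1.11, kurims p.49) -/
abbrev ofGaloisCyclotomeCor110 (T : GalTwistInput S) (R : GalRigidityInput A) (D : MonoThetaRigidityData S)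
    (C : GalCorPiXInput A D) : GaloisPairRigidityData A :=
  ofGaloisCyclotome T R (GalThetaSyncInput.ofMonoThetaRigidityData D C)

/-- Its `Π`-transport (w5-d089's reduced `LDTransport`) — Cor. 1.10's `mapInt`.
[claim: Mochizuki2012, status: disputed] (IUTchII §1 Cor 1.11, kurims p.49) -/
abbrev ofGaloisCyclotomeCor110LD (T : GalTwistInput S) (R : GalRigidityInput A) (D : MonoThetaRigidityData S)
    (C : GalCorPiXInput A D) : (ofGaloisCyclotomeCor110 T R D C).LDTransport :=
  ofGaloisCyclotomeLD T R (GalThetaSyncInput.ofMonoThetaRigidityData D C)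

/-- **Equivariance of the orbit (b)** ([IUTchII] Cor. 1.11: "the topological `Π`-module constituted by the
codomain of `(*bs-Gal_{G,Π})`"): every member `φ = μ_Ẑ(e) ≫ corPiX` of `(*bs-Gal_{G,Π})`, `e : G ⥲ Π/Δ`, is
SEMILINEAR — for `g ∈ G` acting on `μ_Ẑ(G)` by the cyclotomic character (conjugation) and any `x ∈ Π` over
`e(g) ∈ Π/Δ`, `φ (g • ζ) = x • φ ζ`. PROVED (`galCyclotomeMap_smul` + `corPiX_equivariant`).
[claim: Mochizuki2012, status: disputed] (IUTchII §1 Cor 1.11, kurims p.49) -/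
theorem orbitB_equivariant (D : MonoThetaRigidityData S)
    (C : GalCorPiXInput A D) (P : IsoClass S.PiX) (G : IsoClass S.Gk) (e : G ⟶ A.quotObj P) (g : G.G)
    (x : P.G) (hx : (QuotientGroup.mk x : P.G ⧸ A.Delta P) = IsoClass.homIso e g) (ζ : G.galCyclotome) :
    ((IsoClass.galCyclotomeMap e).trans (C.corPiX P))
        (haveI := G.compactSpace_carrier; g • ζ) =
      D.actInt P x (((IsoClass.galCyclotomeMap e).trans (C.corPiX P)) ζ) := by
  rw [MulEquiv.trans_apply, MulEquiv.trans_apply, IsoClass.galCyclotomeMap_smul, ← hx]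
  exact C.corPiX_equivariant P x _

end GaloisPairRigidityData

/-- **IUTchII:Cor1.11 — the functor `ℛ → ℱ` whose `(l·Δ_Θ)`-entry is Cor. 1.10's** (kurims p. 49 ll. 36–44):
w5-d089's `cor111FunctorOfMapLD` at the instance over Cor. 1.10's family. [claim: Mochizuki2012, status: disputed]
(IUTchII §1 Cor 1.11, kurims p.49) -/
abbrev cor111FunctorCor110 [CompactSpace S.Gk] {A : AbsTopMonoids S} (T : GalTwistInput S)
    (R : GalRigidityInput A) (D : MonoThetaRigidityData S) (C : GalCorPiXInput A D) (Γ : Subgroup ZHatUnits)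
    (Γ' : Type u) [Group Γ'] : IsoClass S.PiX × TwistedIsoClass S.Gk Γ' ⥤ Cor111Tuple.{u} :=
  cor111FunctorGalois T R (GalThetaSyncInput.ofMonoThetaRigidityData D C) Γ Γ'

/-- "`Ψ_ℛ : ℛ → ℛ†` is multiradially defined" at it ([IUTchII] Cor. 1.11, p. 49 ll. 44–46).
[claim: Mochizuki2012, status: disputed] (IUTchII §1 Cor 1.11, kurims p.49) -/
theorem cor111FunctorCor110_multiradiallyDefined [CompactSpace S.Gk] {A : AbsTopMonoids S} (T : GalTwistInput S)
    (R : GalRigidityInput A) (D : MonoThetaRigidityData S) (C : GalCorPiXInput A D) (Γ : Subgroup ZHatUnits)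
    (Γ' : Type u) [Group Γ'] :
    ((ex18iii S Γ').toDagger (cor111FunctorCor110 T R D C Γ Γ')).IsMultiradiallyDefined :=
  cor111FunctorGalois_multiradiallyDefined T R _ Γ Γ'

/-- The `(l·Δ_Θ)(Π)`-entry of the tuple at `(Π, G)` IS Cor. 1.10's `intCyc Π` (definitional check).
[claim: Mochizuki2012, status: disputed] (IUTchII §1 Cor 1.11, kurims p.49) -/
theorem cor111FunctorCor110_obj_L [CompactSpace S.Gk] {A : AbsTopMonoids S} (T : GalTwistInput S)
    (R : GalRigidityInput A) (D : MonoThetaRigidityData S) (C : GalCorPiXInput A D) (Γ : Subgroup ZHatUnits)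
    (Γ' : Type u) [Group Γ'] (X : IsoClass S.PiX × TwistedIsoClass S.Gk Γ') :
    ((cor111FunctorCor110 T R D C Γ Γ').obj X).L = ↥(D.intCyc X.1) :=
  rfl

/-- The `(l·Δ_Θ)`-component of the induced morphism along `(h, (e, γ))` IS Cor. 1.10's transport `mapInt h`
(definitional check: the two corollaries' functors agree on `(l·Δ_Θ)`). [claim: Mochizuki2012, status: disputed]
(IUTchII §1 Cor 1.11, kurims p.49) -/
theorem cor111FunctorCor110_map_l [CompactSpace S.Gk] {A : AbsTopMonoids S} (T : GalTwistInput S)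
    (R : GalRigidityInput A) (D : MonoThetaRigidityData S) (C : GalCorPiXInput A D) (Γ : Subgroup ZHatUnits)
    (Γ' : Type u) [Group Γ'] {X Y : IsoClass S.PiX × TwistedIsoClass S.Gk Γ'} (f : X ⟶ Y) :
    ((cor111FunctorCor110 T R D C Γ Γ').map f).l = D.mapInt f.1 :=
  rfl

end Literature.IUT.HodgeArakelov

end
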